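import Summits.ABC.ABC.Theorems.RibetTakahashiSplitManyPrimeValuationProductFreyClassSuffices
import Summits.ABC.ABC.Theorems.RibetTakahashiSplitSubexpABCManyPrimes
import Summits.ABC.ABC.Theorems.RibetTakahashiSplitAbcValuationProductReductions

/-!
# `SubexpABCManyPrimes`: the logical position of the milestone (what implies it)

The route item `Summit.ABC.ABC.Theses.RibetTakahashiSplit.SubexpABCManyPrimes` (stmt-ABC-1568) is
the stand-alone milestone of route `RibetTakahashiSplit`: for every `ε > 0` there is `κ` with
`log c ≤ κ · rad(abc)^ε` for all abc triples with `ω(abc) ≥ 5` — a sub-exponential abc bound in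
the many-prime regime. As a bare statement it is OPEN: the unconditional record for all triples is
Stewart–Yu 2001 (`log c ≤ C R^{1/3} (log R)^3`, the slice `ε > 1/3`, recorded in
`RibetTakahashiSplitSubexpABCManyPrimesKnownRange.lean`), and the many-prime hypothesis helps no
known method; Pasten 2024 Thm 1.4 covers only the complementary regimes `min P(·)` small or
`a ≤ c^{1−η}` (`Literature.Barriers.ABC.pasten2024_thm_1_4_1/2`). This file records, by DECL NAME
and kernel-checked, everything in the tree that implies the milestone, so that the item closes by
a one-liner the moment any of them lands:

* `subexpABCManyPrimes_of_manyPrimeValuationProductFrey` — from the crux r2F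
  `ManyPrimeValuationProductFrey` (stmt-ABC-15149; the route's intended source, via glue A on the
  Frey class `subexpABCManyPrimes_of_manyPrimeFreyClass`);
* (already in the tree) `subexpABCManyPrimes_of_manyPrimeValuationProduct` — from the whole-class
  r2 `ManyPrimeValuationProduct` (stmt-ABC-1561);
* `subexpABCManyPrimes_of_abcValuationProduct` — from the sibling milestone `AbcValuationProduct`
  (stmt-ABC-1567; glue C gives the bound for ALL triples, drop `ω ≥ 5`);
* `SubexpABCManyPrimes.subexp_of_polynomialBound` — ANY polynomial bound `c ≤ C · rad(abc)^A`
  gives `log c ≤ κ_ε rad^ε` for every `ε` and all triples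
  (`log c ≤ log C + A log R ≤ (log C + A/ε) R^ε`): the milestone lies below every polynomial abc
  statement, in particular
* `subexpABCManyPrimes_of_weakABC` — from `WeakABCConjecture` (`c < rad²`, abc.S02),
* `subexpABCManyPrimes_of_abc` — from the summit `ABC` (so NO refutation of the milestone exists
  short of `¬ ABC`), and
* `subexpABCManyPrimes_of_weightedSzpiroBound` — from the crux r3′ `WeightedSzpiroBound`
  (stmt-ABC-3272) alone, through `WeightedSzpiroBound.abc_of`.

Not here: any unconditional proof (none is known for `ε ≤ 1/3`).
-/

-- `Summit.<Summit>.<Problem>` is the mandated summit-side namespace (CONVENTIONS §2); for the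
-- single-conjunct summit `ABC` the two coincide, so the duplicate `ABC.ABC` is deliberate.

set_option linter.dupNamespace false

namespace Summit.ABC.ABC.Theses.RibetTakahashiSplit
/-- **Record of the dropped route item `SubexpABCManyPrimes`** = stmt-ABC-1568 (ledger signature verbatim; NOT a
route item): the milestone "sub-exponential abc in the many-prime regime" was dropped from route RibetTakahashiSplit
on 2026-08-16T14:16Z (items-cap autofix, item closed `moot`; its text survives in the route file as a comment), so
`Summit.ABC.ABC.Theses.RibetTakahashiSplit.SubexpABCManyPrimes` no longer exists and this accepted module stopped
elaborating (buildfix lane 2026-08-20). Re-created here under its original name so the proved reductions keep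
building; the statement of every previously accepted declaration in this file is unchanged. An OPEN statement
as a bare proposition (known only for `ε > 1/3`), posed as a `Prop`, never asserted. -/
def SubexpABCManyPrimes : Prop :=
  ∀ ε : ℝ, 0 < ε → ∃ κ : ℝ, ∀ a b c : ℕ, Literature.NumberTheory.DiophantineGeometry.IsABCTriple a b c → 5 ≤ (a * b * c).primeFactors.card → Real.log c ≤ κ * ((Literature.NumberTheory.DiophantineGeometry.rad a b c : ℕ) : ℝ) ^ ε
end Summit.ABC.ABC.Theses.RibetTakahashiSplit

namespace Summit.ABC.ABC.Theorems

open Literature.NumberTheory.DiophantineGeometry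
open Summit.ABC.ABC.Theses.RibetTakahashiSplit

/-! ### From the route's cruxes and milestones, by decl name -/

/-- **The closing lemma-in-waiting.** The crux r2F `ManyPrimeValuationProductFrey`
(stmt-ABC-15149: `T(E) ≤ C_ε N^ε` on the Frey–Hellegouarch class with `≥ 4` odd multiplicative
primes) implies the milestone `SubexpABCManyPrimes`; this is glue A on the Frey class
(`subexpABCManyPrimes_of_manyPrimeFreyClass`, whose hypothesis is the body of the crux decl).
When the crux lands, `subexpABCManyPrimes_of_manyPrimeValuationProductFrey ‹_›` closes
stmt-ABC-1568. [cite: BombieriGubler2006, Ex. 12.5.10] -/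
theorem subexpABCManyPrimes_of_manyPrimeValuationProductFrey
    (h : ManyPrimeValuationProductFrey) : SubexpABCManyPrimes :=
  -- (buildfix 2026-08-20: non-deprecated name of the same glue lemma)
  subexpManyPrimes_of_manyPrimeFreyClass h

/-- **Milestone ladder.** The sibling milestone `AbcValuationProduct` (stmt-ABC-1567,
`∏_{p ∣ abc} v_p(abc) ≤ K_ε rad^ε` for all triples) implies `SubexpABCManyPrimes`: glue C
(`subexp_of_abcValuationProduct`) gives `log c ≤ κ_ε rad^ε` for ALL abc triples, and the
many-prime hypothesis is simply dropped. `[folklore]` -/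
theorem subexpABCManyPrimes_of_abcValuationProduct (h : AbcValuationProduct) :
    SubexpABCManyPrimes :=
  fun ε hε => (subexp_of_abcValuationProduct h ε hε).imp fun _ hκ a b c habc _ => hκ a b c habc

/-! ### Below every polynomial abc statement -/

/-- **Any polynomial bound gives sub-exponential abc for every `ε`.** If `c ≤ C · rad(abc)^A` for
all abc triples (some real `A`, `C`), then for every `ε > 0` there is `κ` with
`log c ≤ κ · rad(abc)^ε` on ALL abc triples: with `C' = max(C,1)`, `A' = max(A,0)` and
`R = rad(abc) ≥ 2`, `log c ≤ log C' + A' log R`, `log R ≤ R^ε/ε` and `1 ≤ R^ε`, so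
`κ = log C' + A'/ε` works. `[folklore]` -/
theorem SubexpABCManyPrimes.subexp_of_polynomialBound {A C : ℝ}
    (h : ∀ a b c : ℕ, IsABCTriple a b c → (c : ℝ) ≤ C * (rad a b c : ℝ) ^ A) :
    ∀ ε : ℝ, 0 < ε → ∃ κ : ℝ, ∀ a b c : ℕ, IsABCTriple a b c →
      Real.log c ≤ κ * (rad a b c : ℝ) ^ ε := by
  intro ε hε
  refine ⟨Real.log (max C 1) + max A 0 / ε, fun a b c habc => ?_⟩
  have hc0 : (0 : ℝ) < c := by exact_mod_cast lt_of_lt_of_le two_pos habc.two_le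
  have hR1 : (1 : ℝ) ≤ (rad a b c : ℝ) := by
    exact_mod_cast le_trans (by norm_num) habc.two_le_rad
  have hR0 : (0 : ℝ) < (rad a b c : ℝ) := one_pos.trans_le hR1
  have hC1 : (1 : ℝ) ≤ max C 1 := le_max_right _ _
  have hC0 : (0 : ℝ) < max C 1 := one_pos.trans_le hC1
  have hA0 : (0 : ℝ) ≤ max A 0 := le_max_right _ _
  have h1 : (c : ℝ) ≤ max C 1 * (rad a b c : ℝ) ^ (max A 0) :=
    calc (c : ℝ) ≤ C * (rad a b c : ℝ) ^ A := h a b c habc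
      _ ≤ max C 1 * (rad a b c : ℝ) ^ A :=
          mul_le_mul_of_nonneg_right (le_max_left _ _) (Real.rpow_nonneg hR0.le _)
      _ ≤ max C 1 * (rad a b c : ℝ) ^ (max A 0) :=
          mul_le_mul_of_nonneg_left (Real.rpow_le_rpow_of_exponent_le hR1 (le_max_left _ _))
            hC0.le
  have h2 : Real.log c ≤ Real.log (max C 1) + max A 0 * Real.log (rad a b c : ℝ) := by
    calc Real.log c ≤ Real.log (max C 1 * (rad a b c : ℝ) ^ (max A 0)) :=
          Real.log_le_log hc0 h1
      _ = Real.log (max C 1) + max A 0 * Real.log (rad a b c : ℝ) := by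
          rw [Real.log_mul hC0.ne' (Real.rpow_pos_of_pos hR0 _).ne', Real.log_rpow hR0]
  have hlog : Real.log (rad a b c : ℝ) ≤ (rad a b c : ℝ) ^ ε / ε :=
    Real.log_le_rpow_div hR0.le hε
  have hRε : 1 ≤ (rad a b c : ℝ) ^ ε := Real.one_le_rpow hR1 hε.le
  have hlogC : 0 ≤ Real.log (max C 1) := Real.log_nonneg hC1
  calc Real.log c ≤ Real.log (max C 1) + max A 0 * Real.log (rad a b c : ℝ) := h2
    _ ≤ Real.log (max C 1) * (rad a b c : ℝ) ^ ε + max A 0 * ((rad a b c : ℝ) ^ ε / ε) :=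
        add_le_add (le_mul_of_one_le_right hlogC hRε) (mul_le_mul_of_nonneg_left hlog hA0)
    _ = (Real.log (max C 1) + max A 0 / ε) * (rad a b c : ℝ) ^ ε := by ring

/-- The weak abc conjecture `c < rad(abc)²` (abc.S02, `WeakABCConjecture`) implies the milestone
(polynomial bound with `A = 2`, `C = 1`; the many-prime hypothesis is dropped). `[folklore]` -/
theorem subexpABCManyPrimes_of_weakABC (h : WeakABCConjecture) : SubexpABCManyPrimes := by
  have hpoly : ∀ a b c : ℕ, IsABCTriple a b c → (c : ℝ) ≤ 1 * (rad a b c : ℝ) ^ (2 : ℝ) :=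
    fun a b c habc => by
      rw [one_mul, Real.rpow_two]
      exact_mod_cast (h a b c habc).le
  exact fun ε hε => (SubexpABCManyPrimes.subexp_of_polynomialBound hpoly ε hε).imp
    fun _ hκ a b c habc _ => hκ a b c habc

/-- **The milestone follows from the summit**: `ABC → SubexpABCManyPrimes` (abc at `ε = 1` is the
polynomial bound `c < C rad²`). In particular no refutation of stmt-ABC-1568 exists short of
`¬ ABC`. `[folklore]` -/
theorem subexpABCManyPrimes_of_abc (h : _root_.ABC) : SubexpABCManyPrimes := by
  obtain ⟨C, -, hC⟩ := (ABC_iff.mp h) 1 one_pos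
  exact fun ε hε => (SubexpABCManyPrimes.subexp_of_polynomialBound (A := 1 + 1) (C := C)
    (fun a b c habc => (hC a b c habc).le) ε hε).imp fun _ hκ a b c habc _ => hκ a b c habc

/-- The crux r3′ `WeightedSzpiroBound` (stmt-ABC-3272) ALONE implies the milestone, because it
implies `ABC` (`WeightedSzpiroBound.abc_of`). `[folklore]` -/
theorem subexpABCManyPrimes_of_weightedSzpiroBound (h : WeightedSzpiroBound) :
    SubexpABCManyPrimes :=
  subexpABCManyPrimes_of_abc (WeightedSzpiroBound.abc_of h)

end Summit.ABC.ABC.Theorems
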